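import Summits.BirchSwinnertonDyer.BirchSwinnertonDyer.Theorems.CMKolyvaginAtInertTwoCMKolyvaginConjectureAtInertTwoSelmerTriggerTwinShaTrivialLaw
import Summits.BirchSwinnertonDyer.BirchSwinnertonDyer.Theorems.CMKolyvaginAtInertTwoCMKolyvaginConjectureAtInertTwoObstructionClassSelmerEigenOnStubFrame
import HarnessLib

/-!
# Route `CMKolyvaginAtInertTwo`, crux `CMKolyvaginConjectureAtInertTwo` (stmt-BirchSwinnertonDyer-24648),
# stub `stub_positiveDepth` — THE TWO-BIT LAW ON TWIN-`Ш`-TRIVIAL FRAMES: if `Ш(E^{(d_K)}/ℚ)[2^∞] = 0` then Kolyvagin's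
# first descent at `2` drops AT MOST TWO bits at every deep prime, so at depth `M₀ ≥ 3` NO deep prime level witnesses
# the crux (a prime-level witness `ℓ` has Kolyvagin index `M(ℓ) < M₀`) — WITHOUT any BSD hypothesis

Seat `leafhand-bsd-cmkolyvaginatinert-10` g0 (cell `bsd-eis`); helper `--supports stmt-BirchSwinnertonDyer-24648`.
THEOREMS ONLY: no definition, no named fact introduced, no `sorry`; no stub, crux or summit closed; BSD is proved
for no curve.  File 3 of this seat (file 1 `…SelmerTriggerAnatomyOnGivenFrame`, file 2 `…SelmerTriggerTwinShaTrivialLaw`).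

WHAT.  Hand 6 proved the ONE-bit law on trivial-`Ш(E/K)` frames (`pow_dvd_derivedPoint_of_sha_primaryComponent_eq_bot`:
`Ш(E/K)[2^∞] = ⊥ ⟹ 2^{M₀−1} ∣ P_e(ℓ)` at every deep prime).  Hand 2 proved, GRANTED BSD₂(E) and five prints, that on
`Σ ≥ 2` frames every deep derived point is `2`-divisible.  Here, from file 2's twin-`Ш` law (gk2-p4's Kramer mechanism)
applied to the strict-descent obstruction class `s_ℓ = 2^{L−M₀}·c_L(e)` of hands 5/6 (which is `w(E)`-signed by hand 8's
`conjAct_obstructionClass_eq_rootNumber_smul` and Selmer by hand 5's `obstructionClass_mem_selmerGroup`):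

* §1 `pow_sub_two_dvd_derivedPoint_of_twinShaTrivial` — **TWO-BIT LAW.**  Frame: `ρ̄_{E,2}` onto, odd Tamagawa product; `K`
  imaginary quadratic, odd `d_K ≠ −3`, Heegner; Gross 3.7 (2) `h37` by name; `c ≠ 1`; the `ε`-line (`ε = −w(E)`); `w(E) = −1`;
  **`Ш(E^{(d_K)}/ℚ)[2^∞] = 0`**; a conductor-`1` datum with `2^{M₀} ∣ P(1)`, `2 ≤ M₀ ≤ L`.  Then for EVERY Zhang–Kolyvagin prime `ℓ`
  at `2` of index `≥ L` and EVERY datum `e` of conductor `ℓ`: **`2^{M₀−2} ∣ P_e(ℓ)` in `E(K[ℓ])`** (file 2 §3: `4·s_ℓ = 0`; hand 6's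
  order ladder `2^j·s_ℓ = 0 ⟺ 2^{M₀−j} ∣ P(ℓ)`).
* §2 `two_dvd_derivedPoint_of_three_le_of_twinShaTrivial` — hence at `M₀ ≥ 3`: **`P_e(ℓ) ∈ 2E(K[ℓ])`** for every such `ℓ, e`.
* §3 `kolyvaginIndex_lt_of_not_two_dvd_of_twinShaTrivial` — in the crux's currency: on such a frame with `2^{M₀} ∣ P(1)`,
  `M₀ ≥ 3`, **a prime-level witness `(ℓ, e)` of `CMKolyvaginConjectureAtInertTwo` (`P_e(ℓ) ∉ 2E(K[ℓ])`) has `M(ℓ) < M₀`** —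
  it is SHALLOW relative to the depth (`M(ℓ) = ord₂(ℓ+1)` on H₂, as `a_ℓ = 0`): Kolyvagin's `2^{M₀}`-descent never sees it.

REPAIR CENSUS (this file's line): on twin-`Ш`-trivial frames (⊆ `Σ ≥ 1`, see file 2's census remark) of depth `M₀ ≥ 3` the
crux as typed can only be witnessed by a COMPOSITE level or by a prime `ℓ` with `ord₂(ℓ+1) < M₀`; the `2^{M₀}`-descent road
(hands 5–9, file 1 §1) is closed there at prime level (file 2 §4) and yields `2`-DIVISIBILITY instead (§2).  Unconditional
in BSD; conditional on the displayed `h37` (named fact), `ε`-line, `w(E) = −1`, `Ш(E^{(d_K)}/ℚ)[2^∞] = 0`.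
HONEST FRAMING.  Composition of landed theorems (hands 5, 6, 8; gk2-p4; files 1–2); nothing here touches the research core
of `stub_positiveDepth`; closes nothing; BSD is proved for no curve.
References: [cite: McCallumLMS1991, §4 Cor. 4.5, §5 (the class d, Prop. 5.2, Thm. 5.4)] [cite: GrossLMS1991, Prop. 3.7 (2), §5 (5.1),
Prop. 5.3, Prop. 5.4 (2)] [cite: Kramer1981, Thm. 1] [cite: WZhang2014, §3.7 (M(ℓ))]
presearch: composition of tree theorems only (see files 1–2).
-/

set_option autoImplicit false
set_option linter.dupNamespace false -- the Theorems namespace repeats the summit name by design (D-0017)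

noncomputable section
open scoped Classical
open Field NumberField IsDedekindDomain Function WeierstrassCurve
open Literature.NumberTheory.EllipticCurves
open Literature.NumberTheory.EllipticCurves.ModularForms
open Literature.NumberTheory.GaloisRepresentations
open Literature.NumberTheory.GaloisCohomology
open Literature.NumberTheory.EllipticCurves.GrossLMS1991 (prop37_2_reductionCongruence_inert)
open Summit.BirchSwinnertonDyer.BirchSwinnertonDyer.Theorems.CMKolyvaginFirstDescentTwo
  (obstructionClass_mem_selmerGroup conjAct_obstructionClass_eq_rootNumber_smul pow_zsmul_obstructionClass_eq_zero_iff)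

namespace Summit.BirchSwinnertonDyer.BirchSwinnertonDyer.Theorems.CMKolyvaginFirstDescentTwoOnGivenFrame

variable (W : WeierstrassCurve ℚ) [W.IsElliptic] [W.IsGloballyMinimal] [NeZero (W.conductorNorm ℤ)]
  {K : Type} [Field K] [NumberField K]

/-! ## §1 The two-bit law -/

/-- **TWO-BIT LAW: `Ш(E^{(d_K)}/ℚ)[2^∞] = 0 ⟹ 2^{M₀−2} ∣ P_e(ℓ)` at every deep prime.**  Frame: `W` globally minimal with
`ρ̄_{E,2}` onto and odd Tamagawa product; `K` imaginary quadratic, odd `d_K ≠ −3`, Heegner for `N_E`; Gross 1991 Prop. 3.7 (2) at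
`(W, K)` by name; a conjugation `c ≠ 1`; the `ε`-line for `E(K)` (`ε = −w(E)`, binder `hline`); `w(E) = −1` (binder `hw`); the
twist `W.quadraticTwist d_K` with `Ш[2^∞] = 0` (binder `hT0`); a conductor-`1` datum with `2^{M₀} ∣ P(1)`, `2 ≤ M₀ ≤ L`; `ℓ` a
Zhang–Kolyvagin prime at `2` of index `≥ L`; `e` ANY datum of conductor `ℓ`.  Then `2^{M₀−2} ∣ P_e(ℓ)`: the obstruction class
`s_ℓ` is Selmer (hand 5) and `w(E)`-signed (hand 8), so `4·s_ℓ = 0` by file 2 §3, and hand 6's order ladder converts.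
[cite: McCallumLMS1991, §4 Cor. 4.5, §5 (the class d, Prop. 5.2)] [cite: GrossLMS1991, Prop. 3.7 (2), §5 Prop. 5.3, 5.4 (2)]
[cite: Kramer1981, Thm. 1] -/
theorem pow_sub_two_dvd_derivedPoint_of_twinShaTrivial (hρ2 : W.HasSurjectiveModNGaloisRep 2)
    (hT : Odd W.tamagawaProduct)
    (hK : IsImaginaryQuadratic K) (hodd : Odd (NumberField.discr K)) (h3 : NumberField.discr K ≠ -3)
    (hHe : SatisfiesHeegnerHypothesis (W.conductorNorm ℤ) K)
    (h37 : prop37_2_reductionCongruence_inert (W.conductorNorm ℤ) W K) {c : K ≃ₐ[ℚ] K} (hc : c ≠ 1)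
    (hline : ∀ x : (W.baseChange K).toAffine.Point,
      IsOfFinAddOrder (Affine.Point.map (W' := W) (c : K →ₐ[ℚ] K) x - (-W.rootNumber) • x))
    (hw : W.rootNumber = -1)
    (hT0 : ∀ x ∈ AddCommGroup.primaryComponent (↥(W.quadraticTwist (NumberField.discr K : ℚ)).sha) 2, x = 0)
    (Dt : ModularParametrizationData W (W.conductorNorm ℤ)) (β : ℤ) (ι : K →+* ℂ)
    (d₁ : KolyvaginHeegnerData Dt β ι 1) {M₀ L : ℕ} (hM₀ : 2 ≤ M₀) (hML : M₀ ≤ L)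
    (hdiv : ∃ Q : (W.baseChange (ringClassField K ι 1)).toAffine.Point,
      ((2 ^ M₀ : ℕ) : ℤ) • Q = d₁.derivedPoint)
    {ℓ : ℕ} (hKol : Zhang2014.IsKolyvaginPrime (W.conductorNorm ℤ) W K 2 ℓ)
    (hidx : L ≤ Zhang2014.kolyvaginIndex W 2 ℓ) (e : KolyvaginHeegnerData Dt β ι ℓ) :
    ∃ Q : (W.baseChange (ringClassField K ι ℓ)).toAffine.Point, ((2 ^ (M₀ - 2) : ℕ) : ℤ) • Q = e.derivedPoint := by
  obtain ⟨hs, -, -⟩ := obstructionClass_mem_selmerGroup W hρ2 hT hK hodd h3 hHe h37 Dt β ι d₁ hML hdiv hKol hidx e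
  have hL : 1 ≤ L := le_trans (by omega) hML
  have hsν := conjAct_obstructionClass_eq_rootNumber_smul W hρ2 hK hodd h3 hHe hc Dt β ι d₁ (M₀ := M₀) hL hKol hidx e
  have h4 := four_zsmul_eq_zero_of_selmer_eigen_of_twinShaTrivial W hρ2 hK hc hT0 hw hline hs hsν
  refine (pow_zsmul_obstructionClass_eq_zero_iff W hρ2 hK hodd h3 hHe Dt β ι d₁ hM₀ hML hKol hidx e).mp ?_
  rw [Nat.cast_pow 2 2]
  exact h4

/-! ## §2 Depth `≥ 3`: every deep prime-level derived point is `2`-divisible -/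

/-- **`Ш(E^{(d_K)}/ℚ)[2^∞] = 0` and depth `M₀ ≥ 3` ⟹ `P_e(ℓ) ∈ 2E(K[ℓ])` for every deep `ℓ` and every datum `e`.**  Same
frame as `pow_sub_two_dvd_derivedPoint_of_twinShaTrivial` with `3 ≤ M₀ ≤ L`: `2^{M₀−2} ∣ P_e(ℓ)` and `M₀ − 2 ≥ 1`.  Compare
hand 2's `two_dvd_derivedPoint_of_deep_of_bsdp_of_prints` (BSD₂ + prints, `Σ ≥ 2`): here NO BSD hypothesis.
[cite: McCallumLMS1991, §5 (Prop. 5.2, Thm. 5.4)] [cite: GrossLMS1991, Prop. 3.7 (2), §5 Prop. 5.3] [cite: Kramer1981, Thm. 1] -/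
theorem two_dvd_derivedPoint_of_three_le_of_twinShaTrivial (hρ2 : W.HasSurjectiveModNGaloisRep 2)
    (hT : Odd W.tamagawaProduct)
    (hK : IsImaginaryQuadratic K) (hodd : Odd (NumberField.discr K)) (h3 : NumberField.discr K ≠ -3)
    (hHe : SatisfiesHeegnerHypothesis (W.conductorNorm ℤ) K)
    (h37 : prop37_2_reductionCongruence_inert (W.conductorNorm ℤ) W K) {c : K ≃ₐ[ℚ] K} (hc : c ≠ 1)
    (hline : ∀ x : (W.baseChange K).toAffine.Point,
      IsOfFinAddOrder (Affine.Point.map (W' := W) (c : K →ₐ[ℚ] K) x - (-W.rootNumber) • x))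
    (hw : W.rootNumber = -1)
    (hT0 : ∀ x ∈ AddCommGroup.primaryComponent (↥(W.quadraticTwist (NumberField.discr K : ℚ)).sha) 2, x = 0)
    (Dt : ModularParametrizationData W (W.conductorNorm ℤ)) (β : ℤ) (ι : K →+* ℂ)
    (d₁ : KolyvaginHeegnerData Dt β ι 1) {M₀ L : ℕ} (hM₀ : 3 ≤ M₀) (hML : M₀ ≤ L)
    (hdiv : ∃ Q : (W.baseChange (ringClassField K ι 1)).toAffine.Point,
      ((2 ^ M₀ : ℕ) : ℤ) • Q = d₁.derivedPoint)
    {ℓ : ℕ} (hKol : Zhang2014.IsKolyvaginPrime (W.conductorNorm ℤ) W K 2 ℓ)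
    (hidx : L ≤ Zhang2014.kolyvaginIndex W 2 ℓ) (e : KolyvaginHeegnerData Dt β ι ℓ) :
    ∃ Q : (W.baseChange (ringClassField K ι ℓ)).toAffine.Point, (2 : ℤ) • Q = e.derivedPoint := by
  obtain ⟨Q, hQ⟩ := pow_sub_two_dvd_derivedPoint_of_twinShaTrivial W hρ2 hT hK hodd h3 hHe h37 hc hline hw hT0 Dt β ι d₁
    (by omega) hML hdiv hKol hidx e
  refine ⟨(((2 : ℕ) : ℤ) ^ (M₀ - 3)) • Q, ?_⟩
  have h2 : (2 : ℤ) * (((2 : ℕ) : ℤ) ^ (M₀ - 3)) = ((2 : ℕ) : ℤ) ^ (M₀ - 2) := by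
    rw [Nat.cast_ofNat, ← pow_succ', show M₀ - 3 + 1 = M₀ - 2 by omega]
  rw [smul_smul, h2, ← Nat.cast_pow]
  exact hQ

/-! ## §3 In the crux's currency: a prime-level witness is shallow relative to the depth -/

/-- **ON A TWIN-`Ш`-TRIVIAL FRAME OF DEPTH `M₀ ≥ 3`, A PRIME-LEVEL WITNESS OF THE CRUX HAS KOLYVAGIN INDEX `< M₀`.**  Same
frame as `two_dvd_derivedPoint_of_three_le_of_twinShaTrivial` with `2^{M₀} ∣ P(1)`, `M₀ ≥ 3`: if `ℓ` is a Zhang–Kolyvagin prime at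
`2` and some datum `e` of conductor `ℓ` has `P_e(ℓ) ∉ 2E(K[ℓ])` (the conclusion of `CMKolyvaginConjectureAtInertTwo` at `n = ℓ`),
then `M(ℓ) = Zhang2014.kolyvaginIndex W 2 ℓ < M₀` (on H₂, `a_ℓ = 0`, this is `ord₂(ℓ+1) < M₀`).  Contrapositive of §2 at
`L = M₀`.  [cite: McCallumLMS1991, §5 (Prop. 5.2, Thm. 5.4)] [cite: WZhang2014, §3.7 (M(ℓ), Λ)] [cite: Kramer1981, Thm. 1] -/
theorem kolyvaginIndex_lt_of_not_two_dvd_of_twinShaTrivial (hρ2 : W.HasSurjectiveModNGaloisRep 2)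
    (hT : Odd W.tamagawaProduct)
    (hK : IsImaginaryQuadratic K) (hodd : Odd (NumberField.discr K)) (h3 : NumberField.discr K ≠ -3)
    (hHe : SatisfiesHeegnerHypothesis (W.conductorNorm ℤ) K)
    (h37 : prop37_2_reductionCongruence_inert (W.conductorNorm ℤ) W K) {c : K ≃ₐ[ℚ] K} (hc : c ≠ 1)
    (hline : ∀ x : (W.baseChange K).toAffine.Point,
      IsOfFinAddOrder (Affine.Point.map (W' := W) (c : K →ₐ[ℚ] K) x - (-W.rootNumber) • x))
    (hw : W.rootNumber = -1)
    (hT0 : ∀ x ∈ AddCommGroup.primaryComponent (↥(W.quadraticTwist (NumberField.discr K : ℚ)).sha) 2, x = 0)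
    (Dt : ModularParametrizationData W (W.conductorNorm ℤ)) (β : ℤ) (ι : K →+* ℂ)
    (d₁ : KolyvaginHeegnerData Dt β ι 1) {M₀ : ℕ} (hM₀ : 3 ≤ M₀)
    (hdiv : ∃ Q : (W.baseChange (ringClassField K ι 1)).toAffine.Point,
      ((2 ^ M₀ : ℕ) : ℤ) • Q = d₁.derivedPoint)
    {ℓ : ℕ} (hKol : Zhang2014.IsKolyvaginPrime (W.conductorNorm ℤ) W K 2 ℓ) (e : KolyvaginHeegnerData Dt β ι ℓ)
    (hP : ¬ ∃ Q : (W.baseChange (ringClassField K ι ℓ)).toAffine.Point, (2 : ℤ) • Q = e.derivedPoint) :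
    Zhang2014.kolyvaginIndex W 2 ℓ < M₀ := by
  by_contra hidx
  push Not at hidx
  exact hP (two_dvd_derivedPoint_of_three_le_of_twinShaTrivial W hρ2 hT hK hodd h3 hHe h37 hc hline hw hT0 Dt β ι d₁ hM₀
    le_rfl hdiv hKol hidx e)

end Summit.BirchSwinnertonDyer.BirchSwinnertonDyer.Theorems.CMKolyvaginFirstDescentTwoOnGivenFrame

end
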